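import Summits.BirchSwinnertonDyer.BirchSwinnertonDyer.Theses.PrintX10b
import Summits.BirchSwinnertonDyer.BirchSwinnertonDyer.Theorems.PrintX10bHowardRoad
import Summits.BirchSwinnertonDyer.Rank1Residual.X11b.YZCompositeOfFrames
import Summits.BirchSwinnertonDyer.BirchSwinnertonDyer.Theorems.PrintX10bTwoSidedLinkAnyClassNumberX10bOfPrintFacts
import HarnessLib

/-!
# Line `mu-only-transfer-x10b` on crux stmt-BirchSwinnertonDyer-23730 `TwoSidedLinkAnyClassNumberX10b`
(route PrintX10b, r304 = B₃; registry crux decl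
`Summit.BirchSwinnertonDyer.BirchSwinnertonDyer.Theses.PrintX10b.TwoSidedLinkAnyClassNumberX10b`, rev 19).

Seat bsd-idea-5 g2 (D-0145 ideator, lens «transfer»); rev 2 (2026-08-28T06:5xZ): PIN-aware after the cell's
μ-blindness ruling PIN-1 / REF-104 and the lead's (bsd-line-x10b-p3) landed pinned road p607932 / p608225 /
p608727. Published with `ledger crux write` only (W-79: the line of record `composite_transfer_x10b` stays
registered). BSD is not proved by any of this.

## The idea (μ-only transfer)

B₃ takes the tree-family containment `char_Λ(S/ℋ_F)² ⊆ char_Λ(X_tors)` as a HYPOTHESIS and must return the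
two-sided anticyclotomic IMC ∘ Waldspurger identity at `𝟙` (`X11b.IMCWaldspurgerOnTreeGoodAt`). On the printed
road (Yan–Zhu 2026 Thm. 5.7 (1) rational ∘ Thm. 5.9 ∘ BCS 2025 Prop. 4.2.2 ∘ CGLS 2022 Thm. 5.1.3 ∘ JSW 2017
Thm. 3.3.1) the class number enters at ONE joint, the transfer Thm. 5.9 (tree-typed under
`Thm57Hypotheses.not_dvd_classNumber`; the lead's pinned class-free reading is the HYPOTHESIS `h59gp` of
p607932, typing pending as flag «YZ59-anyhK@BCK52-How04»). OBSERVATION of this line: in the composite's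
algebra (`p^k(L) ⊆ (𝓕)`, `p^{k'}(𝓕) ⊆ (L)` rationally; `μ(L) = 0`) the transfer is used ONLY to kill the
μ-discrepancy `(𝓕) = p^m(L)`, and ANY relation `s·L ∈ (𝓕)` with `μ(s) = 0` (one unit coefficient) forces
`m = 0`. So the transfer is needed only μ-LOCALLY — `∃ s, μ(s) = 0 ∧ s·𝓛^BDP ∈ char(𝒳_Gr)·R₀⟦T⟧` — which is
STRICTLY WEAKER than `h59gp` (kernel: `muLocalisedPinned_of_leadPinnedTransfer`) and is invariant under
replacing the family by any μ-free multiple: the identification of the tree family `F` at torsion depth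
`δ = ord_3 h_K ≥ 1` with print's `Λκ_∞` (the TREE-CURRENCY CAVEAT of p607932, the one thing «YZ59-anyhK»
must decide) is then needed only modulo μ, where norm / stabilisation factors (units, `T`-, `(γ−1)`-powers)
are invisible; what is left is `μ(e) = 0` for `z^F = e·κ_∞^{Hg}` — and the family-free Poitou–Tate identity
of [BCK21, Thm. 5.2] with CGLS Thm. 5.1.1 (ERL for `κ_∞^{Hg}`, any class number) delivers exactly that much.

STUBS (2, the ONLY sorries):
* `stub_bdpMem_muLocalised_classFree` (T1, research, L): the μ-localised class-free Thm. 5.9 forward for the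
  tree family, UNPINNED — as the rev-19 crux forces (its containment hypothesis has `F.Dt` free, hence is
  μ-BLIND by PIN-1: for families with `p ∣ F.Dt.c` T1, like the rev-19 crux itself, asserts its conclusion
  essentially outright). Its PINNED form `stub_bdpMem_muLocalised_pinned` (T1p: `¬ (p : ℤ) ∣ F.Dt.c` added,
  the shape of the lead's `h59gp` with the conclusion μ-localised) is the statement of record for the
  announced rev-20 pinned crux; T1 ⇒ T1p and `h59gp` ⇒ T1p in the kernel.
* `stub_muComparison_sLocalised` (T2, closable, M): the s-robust μ-comparison in `R₀⟦T⟧`.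
PROVED here (no sorry): the class-free composite from ANY μ-local membership datum (`MuLocalMembership`) +
T2 + Thm. 5.7 (1) + Prop. 4.2.2 + Thm. 5.1.3 (§1), its valuation currency (§2), the σ-bridge (§3), whence
`TwoSidedLinkAnyClassNumberX10b_of : T1 → T2 → (5.7 (1)) → (4.2.2) → (5.1.3) → JSWAnticyclotomicControl →`
the rev-19 crux BY NAME, and `twoSidedLinkPinned_of : T1p → T2 → … →` the PINNED B₃ body (rev-19 binder list
with the containment hypothesis pinned) (§4); kernel evidence (§5): `h59gp ⇒ T1p`, typed Thm. 5.9 ⇒ T1 at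
`p ∤ h_K` with `s = 1`. No case split on the class number anywhere.
-/

set_option linter.dupNamespace false
set_option autoImplicit false

noncomputable section

open scoped Classical

open PowerSeries WeierstrassCurve NumberField IsDedekindDomain Field
  Literature.NumberTheory.EllipticCurves Literature.NumberTheory.EllipticCurves.ModularForms
  Literature.NumberTheory.EllipticCurves.Rank1Residual
  Literature.NumberTheory.EllipticCurves.Castella2018
  Literature.NumberTheory.EllipticCurves.YanZhu2026
  Literature.NumberTheory.EllipticCurves.JetchevSkinnerWan2017
  Literature.NumberTheory.EllipticCurves.CastellaGrossiLeeSkinner2022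
  Summit.BirchSwinnertonDyer.Rank1Residual
  Summit.BirchSwinnertonDyer.Rank1Residual.X11b.Halves
  Summit.BirchSwinnertonDyer.Rank1Residual.X1.KellerYinHalves
  Summit.BirchSwinnertonDyer.Rank1Residual.X11b.YZComposite

open Literature.NumberTheory.EllipticCurves.Rank1Residual (ClassX10 Surj)

namespace Summit.BirchSwinnertonDyer.BirchSwinnertonDyer.Cruxes.TwoSidedLinkAnyClassNumberX10b.MuOnlyTransferX10b

/-! ## Stub statements as named propositions -/

/-- **T1 — Yan–Zhu 2026 Thm. 5.9 FORWARD, class-number free and μ-localised, for the tree Heegner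
family.** For `(E, K, p)` in the setting of Yan–Zhu §5.2 WITHOUT `p ∤ h_K`, a frame `L` of `𝓛_p^BDP(E/K)`
such that for all data `(D, F, X)` and THE structure map `j`: `char(S/ℋ_F)² ⊆ char(X_tors)` implies
`j(s)·L ∈ char(𝒳_Gr)·R₀⟦T⟧` for some `s ∈ Λ` with a unit coefficient (`μ(s) = 0`). At `p ∤ h_K` this is
the typed Thm. 5.9 with `s = 1` (`YanZhu2026.bdp_mem_of_heegner_le_of_thm59`); beyond print BY NAME at
`p ∣ h_K`: the family-free Poitou–Tate identity of [BCK21, Thm. 5.2] / [YZ26, Thm. 5.9] plus the CGLS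
explicit reciprocity law for `κ_∞^{Hg}` (any class number) plus `μ(e) = 0` for the discrepancy `e` of the
tree family against `κ_∞^{Hg}`.
[cite: YanZhu2024MainConjNonCM, Thm. 5.9 (arXiv:2412.20078v4 l.1283–1293)]
[cite: BurungaleCastellaKim2021, Thm. 5.2 = arXiv:1908.09512 Thm. 4.1]
[cite: CastellaGrossiLeeSkinner2022, Thm. 4.1.1, Rem. 4.1.4, Thm. 5.1.1] -/
def Stmt.stub_bdpMem_muLocalised_classFree : Prop :=
  ∀ (p : ℕ) [Fact p.Prime] (ι' : PadicAlgCl p ≃+* ℂ) (W : WeierstrassCurve ℚ) [W.IsElliptic]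
    [W.IsGloballyMinimal] [NeZero (W.conductorNorm ℤ)] (K : Type) [Field K] [NumberField K]
    (v vbar : HeightOneSpectrum (𝓞 K)) (κ : ZpExtension K p) (γ : absoluteGaloisGroup K)
    [Fact (κ.IsTopGenerator γ)] {f : CuspForm (CongruenceSubgroup.Gamma0 (W.conductorNorm ℤ)) 2}
    (jbar : AlgebraicClosure K →+* ℂ),
    IsNewformOf W f → 3 ≤ p → GoodOrd W p → (W.baseChange K).HasIrreducibleModPGaloisRep p →
    IsImaginaryQuadratic K → SatisfiesHeegnerHypothesis (W.conductorNorm ℤ) K →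
    ((Ideal.span {(p : ℤ)}).primesOver (𝓞 K)).ncard = 2 →
    Odd (NumberField.discr K) → NumberField.discr K ≠ -3 → κ.IsAnticyclotomic →
    (∀ (w : InfinitePlace K) (k : 𝓞 K), k ∈ v.asIdeal ↔ ‖ι'.symm (w.embedding (k : K))‖ < 1) →
    ((p : ℕ) : 𝓞 K) ∈ vbar.asIdeal → vbar ≠ v →
    ∃ (ΩK : ℂ) (Ωp : (unrIntegers p)ˣ) (L : UnrSeries p),
      ΩK ≠ 0 ∧ IsBDPLFunction ι' v κ γ f ΩK ((Ωp : unrIntegers p) : ℂ_[p]) L ∧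
      ∀ (D : (W.baseChange K).LambdaAdicSelmerData κ γ)
        (F : HeegnerFamily (W.conductorNorm ℤ) W K κ jbar)
        (X : (W.baseChange K).SelmerDualData κ γ) (j : ℤ_[p] →+* unrIntegers p),
        (∀ x : ℤ_[p], ((j x : unrIntegers p) : ℂ_[p]) = algebraMap ℚ_[p] ℂ_[p] (x : ℚ_[p])) →
        heegnerCharIdeal D F ^ 2 ≤
            Module.charIdeal (IwasawaAlgebra p) (Submodule.torsion (IwasawaAlgebra p) X.X) →
        ∃ s : IwasawaAlgebra p, (∃ m : ℕ, IsUnit (coeff m s)) ∧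
          PowerSeries.map j s * L ∈
            (AcSelmer.XAc.charIdeal (W.baseChange K) p κ vbar ∅ γ).map (PowerSeries.map j)

/-- **T1p — the PINNED form of T1** (statement of record for the announced rev-20 pinned crux; PIN-1 /
REF-104): the same μ-localised class-free Thm. 5.9 forward, for families whose parametrisation has
`p`-adic-unit Manin constant (`¬ (p : ℤ) ∣ F.Dt.c`, print's normalisation: Perrin-Riou 1987 §1 Conj. B,
BCK21 Conj. 1.1). It is the lead's pinned transfer hypothesis `h59gp` (p607932) with the conclusion
`L ∈ ch·R₀⟦T⟧` WEAKENED to `∃ s, μ(s) = 0 ∧ j(s)·L ∈ ch·R₀⟦T⟧` (kernel: `muLocalisedPinned_of_leadPinnedTransfer`).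
[cite: YanZhu2024MainConjNonCM, Thm. 5.9] [cite: BurungaleCastellaKim2021, Thm. 5.2, Conj. 1.1]
[cite: CastellaGrossiLeeSkinner2022, Thm. 4.1.3 (i), Thm. 5.1.1] -/
def Stmt.stub_bdpMem_muLocalised_pinned : Prop :=
  ∀ (p : ℕ) [Fact p.Prime] (ι' : PadicAlgCl p ≃+* ℂ) (W : WeierstrassCurve ℚ) [W.IsElliptic]
    [W.IsGloballyMinimal] [NeZero (W.conductorNorm ℤ)] (K : Type) [Field K] [NumberField K]
    (v vbar : HeightOneSpectrum (𝓞 K)) (κ : ZpExtension K p) (γ : absoluteGaloisGroup K)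
    [Fact (κ.IsTopGenerator γ)] {f : CuspForm (CongruenceSubgroup.Gamma0 (W.conductorNorm ℤ)) 2}
    (jbar : AlgebraicClosure K →+* ℂ),
    IsNewformOf W f → 3 ≤ p → GoodOrd W p → (W.baseChange K).HasIrreducibleModPGaloisRep p →
    IsImaginaryQuadratic K → SatisfiesHeegnerHypothesis (W.conductorNorm ℤ) K →
    ((Ideal.span {(p : ℤ)}).primesOver (𝓞 K)).ncard = 2 →
    Odd (NumberField.discr K) → NumberField.discr K ≠ -3 → κ.IsAnticyclotomic →
    (∀ (w : InfinitePlace K) (k : 𝓞 K), k ∈ v.asIdeal ↔ ‖ι'.symm (w.embedding (k : K))‖ < 1) →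
    ((p : ℕ) : 𝓞 K) ∈ vbar.asIdeal → vbar ≠ v →
    ∃ (ΩK : ℂ) (Ωp : (unrIntegers p)ˣ) (L : UnrSeries p),
      ΩK ≠ 0 ∧ IsBDPLFunction ι' v κ γ f ΩK ((Ωp : unrIntegers p) : ℂ_[p]) L ∧
      ∀ (D : (W.baseChange K).LambdaAdicSelmerData κ γ)
        (F : HeegnerFamily (W.conductorNorm ℤ) W K κ jbar)
        (X : (W.baseChange K).SelmerDualData κ γ) (j : ℤ_[p] →+* unrIntegers p),
        ¬ (p : ℤ) ∣ F.Dt.c →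
        (∀ x : ℤ_[p], ((j x : unrIntegers p) : ℂ_[p]) = algebraMap ℚ_[p] ℂ_[p] (x : ℚ_[p])) →
        heegnerCharIdeal D F ^ 2 ≤
            Module.charIdeal (IwasawaAlgebra p) (Submodule.torsion (IwasawaAlgebra p) X.X) →
        ∃ s : IwasawaAlgebra p, (∃ m : ℕ, IsUnit (coeff m s)) ∧
          PowerSeries.map j s * L ∈
            (AcSelmer.XAc.charIdeal (W.baseChange K) p κ vbar ∅ γ).map (PowerSeries.map j)

/-- **T2 — the s-robust μ-comparison in `R₀⟦T⟧`** (pure algebra, closable): if `C(p^k)·L ∈ (F')` and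
`C(p^k')·F' ∈ (L)` (the two rational halves of Yan–Zhu Thm. 5.7 (1)), `L` has a first unit
coefficient (`μ(L) = 0`, BCS Prop. 4.2.2 along frame rigidity), and `s'·L ∈ (F')` for SOME `s'` with a
unit coefficient, then `(F') = (L)`. Proof sketch: `F' = C(p^m)·U·L`
(`X11b.YZComposite.exists_eq_C_pow_mul_unit_mul`); `s'·L = F'·h = C(p^m)·U·L·h`, `L ≠ 0`, so
`s' = C(p^m)·U·h`; a unit coefficient of `s'` forces `m = 0`. [folklore; the s = 1 case is
`X11b.YZComposite.span_eq_of_C_pow_mul_mem_of_mem`] -/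
def Stmt.stub_muComparison_sLocalised : Prop :=
  ∀ (p : ℕ) [Fact p.Prime] (F' L s' : UnrSeries p) (k k' n : ℕ),
    C ((p : unrIntegers p) ^ k) * L ∈ Ideal.span ({F'} : Set (UnrSeries p)) →
    C ((p : unrIntegers p) ^ k') * F' ∈ Ideal.span ({L} : Set (UnrSeries p)) →
    (‖((coeff n L : unrIntegers p) : ℂ_[p])‖ = 1 ∧
      ∀ i < n, ‖((coeff i L : unrIntegers p) : ℂ_[p])‖ < 1) →
    (∃ m : ℕ, IsUnit (coeff m s')) →
    s' * L ∈ Ideal.span ({F'} : Set (UnrSeries p)) →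
    Ideal.span ({F'} : Set (UnrSeries p)) = Ideal.span {L}

/-! ## The stubs (the ONLY sorries of the file) -/

theorem stub_bdpMem_muLocalised_classFree : Stmt.stub_bdpMem_muLocalised_classFree := by
  sorry

theorem stub_muComparison_sLocalised : Stmt.stub_muComparison_sLocalised := by
  sorry

/-- T1 ⇒ T1p (forget the pin). -/
theorem muLocalisedPinned_of_unpinned (h : Stmt.stub_bdpMem_muLocalised_classFree) :
    Stmt.stub_bdpMem_muLocalised_pinned := by
  intro p _ ι' W _ _ _ K _ _ v vbar κ γ _ f jbar hf hp hord hirrK hK hHN hsplit hodd h3 hκ hι' hvbar hne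
  obtain ⟨ΩK, Ωp, L, hΩK, hL, hmem⟩ :=
    h p ι' W K v vbar κ γ jbar hf hp hord hirrK hK hHN hsplit hodd h3 hκ hι' hvbar hne
  exact ⟨ΩK, Ωp, L, hΩK, hL, fun D F X j _ hj hle ↦ hmem D F X j hj hle⟩

/-- The pinned statement from the unpinned stub (at rev 20 `Stmt.stub_bdpMem_muLocalised_pinned` is to be
registered and proved DIRECTLY; it is not a `stub_` here so that sorries = registered stubs = 2). -/
theorem bdpMem_muLocalised_pinned_of_stub : Stmt.stub_bdpMem_muLocalised_pinned :=
  muLocalisedPinned_of_unpinned stub_bdpMem_muLocalised_classFree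

/-! ## §0 The μ-local membership datum and its two providers -/

/-- **A μ-local membership datum** at `(v, vbar)` for the form `f`: for every embedding datum `ι'` inducing
`v`, a BDP frame `L` and an `s ∈ Λ` with a unit coefficient such that `s·L ∈ ch_Λ(𝒳_Gr(vbar))·R₀⟦T⟧`. -/
def MuLocalMembership (p : ℕ) [Fact p.Prime] (W : WeierstrassCurve ℚ) (K : Type) [Field K] [NumberField K]
    (v vbar : HeightOneSpectrum (𝓞 K)) (κ : ZpExtension K p) (γ : absoluteGaloisGroup K)
    [Fact (κ.IsTopGenerator γ)] {N : ℕ} (f : CuspForm (CongruenceSubgroup.Gamma0 N) 2) : Prop :=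
  ∀ (ι' : PadicAlgCl p ≃+* ℂ),
    (∀ (w : InfinitePlace K) (k : 𝓞 K), k ∈ v.asIdeal ↔ ‖ι'.symm (w.embedding (k : K))‖ < 1) →
    ∃ (ΩK : ℂ) (Ωp : (unrIntegers p)ˣ) (L : UnrSeries p),
      ΩK ≠ 0 ∧ IsBDPLFunction ι' v κ γ f ΩK ((Ωp : unrIntegers p) : ℂ_[p]) L ∧
      ∃ s : IwasawaAlgebra p, (∃ m : ℕ, IsUnit (coeff m s)) ∧
        PowerSeries.map (toUnr p) s * L ∈
          (AcSelmer.XAc.charIdeal (W.baseChange K) p κ vbar ∅ γ).map (PowerSeries.map (toUnr p))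

/-- Provider 1: T1 and the crux's UNPINNED containment hypothesis. -/
theorem muLocalMembership_of_unpinned (hT1 : Stmt.stub_bdpMem_muLocalised_classFree)
    (W : WeierstrassCurve ℚ) [W.IsElliptic] [W.IsGloballyMinimal] [NeZero (W.conductorNorm ℤ)]
    (p : ℕ) [Fact p.Prime] (hp : 3 ≤ p) (hord : GoodOrd W p)
    (K : Type) [Field K] [NumberField K] (hK : IsImaginaryQuadratic K)
    (hHN : SatisfiesHeegnerHypothesis (W.conductorNorm ℤ) K) (hHp : SatisfiesHeegnerHypothesis p K)
    (hodd : Odd (NumberField.discr K)) (h3 : NumberField.discr K ≠ -3)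
    (hirrK : (W.baseChange K).HasIrreducibleModPGaloisRep p)
    (v vbar : HeightOneSpectrum (𝓞 K)) (hvbar : ((p : ℕ) : 𝓞 K) ∈ vbar.asIdeal) (hne : vbar ≠ v)
    (κ : ZpExtension K p) (hκ : κ.IsAnticyclotomic)
    (γ : absoluteGaloisGroup K) [Fact (κ.IsTopGenerator γ)]
    (Dt : ModularParametrizationData W (W.conductorNorm ℤ))
    (hHow : ∃ (jbar : AlgebraicClosure K →+* ℂ) (D : (W.baseChange K).LambdaAdicSelmerData κ γ)
      (F : HeegnerFamily (W.conductorNorm ℤ) W K κ jbar) (X : (W.baseChange K).SelmerDualData κ γ),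
      heegnerCharIdeal D F ^ 2 ≤
        Module.charIdeal (IwasawaAlgebra p) (Submodule.torsion (IwasawaAlgebra p) X.X)) :
    MuLocalMembership p W K v vbar κ γ Dt.f := by
  intro ι' hι'
  have hsplit : ((Ideal.span {(p : ℤ)}).primesOver (𝓞 K)).ncard = 2 := hHp p Fact.out (dvd_refl p)
  obtain ⟨jbar, D, Fh, X, hle⟩ := hHow
  obtain ⟨ΩK, Ωp, L, hΩK, hL, hmem⟩ :=
    hT1 p ι' W K v vbar κ γ jbar Dt.isNewformOf hp hord hirrK hK hHN hsplit hodd h3 hκ hι' hvbar hne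
  obtain ⟨s, hs, hsL⟩ := hmem D Fh X (toUnr p) (coe_toUnr p) hle
  exact ⟨ΩK, Ωp, L, hΩK, hL, s, hs, hsL⟩

/-- Provider 2: T1p and the PINNED containment hypothesis (rev-20 shape, PIN-1). -/
theorem muLocalMembership_of_pinned (hT1p : Stmt.stub_bdpMem_muLocalised_pinned)
    (W : WeierstrassCurve ℚ) [W.IsElliptic] [W.IsGloballyMinimal] [NeZero (W.conductorNorm ℤ)]
    (p : ℕ) [Fact p.Prime] (hp : 3 ≤ p) (hord : GoodOrd W p)
    (K : Type) [Field K] [NumberField K] (hK : IsImaginaryQuadratic K)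
    (hHN : SatisfiesHeegnerHypothesis (W.conductorNorm ℤ) K) (hHp : SatisfiesHeegnerHypothesis p K)
    (hodd : Odd (NumberField.discr K)) (h3 : NumberField.discr K ≠ -3)
    (hirrK : (W.baseChange K).HasIrreducibleModPGaloisRep p)
    (v vbar : HeightOneSpectrum (𝓞 K)) (hvbar : ((p : ℕ) : 𝓞 K) ∈ vbar.asIdeal) (hne : vbar ≠ v)
    (κ : ZpExtension K p) (hκ : κ.IsAnticyclotomic)
    (γ : absoluteGaloisGroup K) [Fact (κ.IsTopGenerator γ)]
    (Dt : ModularParametrizationData W (W.conductorNorm ℤ))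
    (hHow : ∃ (jbar : AlgebraicClosure K →+* ℂ) (D : (W.baseChange K).LambdaAdicSelmerData κ γ)
      (F : HeegnerFamily (W.conductorNorm ℤ) W K κ jbar) (X : (W.baseChange K).SelmerDualData κ γ),
      ¬ (p : ℤ) ∣ F.Dt.c ∧ heegnerCharIdeal D F ^ 2 ≤
        Module.charIdeal (IwasawaAlgebra p) (Submodule.torsion (IwasawaAlgebra p) X.X)) :
    MuLocalMembership p W K v vbar κ γ Dt.f := by
  intro ι' hι'
  have hsplit : ((Ideal.span {(p : ℤ)}).primesOver (𝓞 K)).ncard = 2 := hHp p Fact.out (dvd_refl p)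
  obtain ⟨jbar, D, Fh, X, hpin, hle⟩ := hHow
  obtain ⟨ΩK, Ωp, L, hΩK, hL, hmem⟩ :=
    hT1p p ι' W K v vbar κ γ jbar Dt.isNewformOf hp hord hirrK hK hHN hsplit hodd h3 hκ hι' hvbar hne
  obtain ⟨s, hs, hsL⟩ := hmem D Fh X (toUnr p) hpin (coe_toUnr p) hle
  exact ⟨ΩK, Ωp, L, hΩK, hL, s, hs, hsL⟩

/-! ## §1 The class-free composite at the trivial character from a μ-local membership datum + T2 + three
printed frame facts (kernel-checked; the §3 derivation of `X11b/YZCompositeOfFrames.lean` with frame 3 := the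
datum and the μ-comparison := T2; no class number, no family anywhere) -/

set_option maxHeartbeats 1600000 in
/-- **Yan–Zhu Thm. 5.7 (1) (rational) + a μ-local membership datum + BCS Prop. 4.2.2 + CGLS Thm. 5.1.3,
composed by T2, at ANY class number**: `𝒳_Gr` is torsion with a generator `𝓕` and `𝓕(0) = u · c_E⁻²(1 − a_p p⁻¹ + p⁻¹)² (log_{ω_E} P / formalIndex)²`, `u ∈ ℤ_pˣ`.
Letter for letter the conclusion of
`YanZhu2026.thm57_thm59_bcs422_cgls513_generator_constantCoeff_of_heegnerDivisibility` at `N = N_E`,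
WITHOUT its binder `¬ p ∣ h_K`.
[cite: YanZhu2024MainConjNonCM, Thm. 5.7 (1), Thm. 5.9] [cite: BurungaleCastellaSkinner2025, Prop. 4.2.2]
[cite: CastellaGrossiLeeSkinner2022, Thm. 5.1.3] [cite: Darmon2004, Prop. 3.11] -/
theorem generator_constantCoeff_of_muLocalMembership (hT2 : Stmt.stub_muComparison_sLocalised)
    (h57 : thm57_isTorsion_charIdealXGr_eq_bdpLFunction)
    (h422 : BurungaleCastellaSkinner2025.prop422_exists_isBDPLFunction_mu_eq_zero)
    (h513 : thm513_exists_isBDPLFunction_valueAtOne_disc)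
    (W : WeierstrassCurve ℚ) [W.IsElliptic] [W.IsGloballyMinimal] [NeZero (W.conductorNorm ℤ)]
    (p : ℕ) [Fact p.Prime] (hp : 3 ≤ p) (hord : GoodOrd W p)
    (K : Type) [Field K] [NumberField K] (hK : IsImaginaryQuadratic K)
    (hHN : SatisfiesHeegnerHypothesis (W.conductorNorm ℤ) K) (hHp : SatisfiesHeegnerHypothesis p K)
    (hodd : Odd (NumberField.discr K)) (h3 : NumberField.discr K ≠ -3)
    (hirrK : (W.baseChange K).HasIrreducibleModPGaloisRep p)
    (ι : K →+* ℚ_[p]) (v vbar : HeightOneSpectrum (𝓞 K))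
    (hv : ∀ x : 𝓞 K, x ∈ v.asIdeal ↔ ‖ι (x : K)‖ < 1)
    (hvbar : ((p : ℕ) : 𝓞 K) ∈ vbar.asIdeal) (hne : vbar ≠ v)
    (κ : ZpExtension K p) (hκ : κ.IsAnticyclotomic)
    (γ : absoluteGaloisGroup K) [Fact (κ.IsTopGenerator γ)]
    (Dt : ModularParametrizationData W (W.conductorNorm ℤ))
    (H : HeegnerDatum (W.conductorNorm ℤ) (NumberField.discr K)) (ιC : K →+* ℂ)
    (P : (W.baseChange K).toAffine.Point)
    (hP : WeierstrassCurve.Affine.Point.map ιC.toRatAlgHom P = heegnerPointComplex Dt H)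
    (hloc : MuLocalMembership p W K v vbar κ γ Dt.f) :
    Module.IsTorsion (IwasawaAlgebra p) (AcSelmer.XAc (W.baseChange K) p κ vbar ∅ γ) ∧
      ∃ F : IwasawaAlgebra p,
        AcSelmer.XAc.charIdeal (W.baseChange K) p κ vbar ∅ γ = Ideal.span {F} ∧
        ∃ u : ℤ_[p]ˣ,
          ((PowerSeries.constantCoeff F : ℤ_[p]) : ℚ_[p]) =
            ((u : ℤ_[p]) : ℚ_[p]) * ((Dt.c : ℚ_[p])⁻¹) ^ 2 *
              (1 - (W.frobeniusTrace p : ℚ_[p]) * (p : ℚ_[p])⁻¹ + (p : ℚ_[p])⁻¹) ^ 2 *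
              ((W.baseChange ℚ_[p]).padicLogPoint (formalIndex W p • padicPointOf W p ι P) /
                (formalIndex W p : ℚ_[p])) ^ 2 := by
  have hpp : p.Prime := Fact.out
  have hp2 : p ≠ 2 := by omega
  have hp2' : 2 < p := by omega
  have hγ : κ.IsTopGenerator γ := Fact.out
  -- `p ∈ v`, `p` split, `p ∤ N_E`, the embedding datum `ι'` inducing `v`
  have hpv : ((p : ℕ) : 𝓞 K) ∈ v.asIdeal := by
    rw [hv, show ι (((p : ℕ) : 𝓞 K) : K) = (p : ℚ_[p]) by simp]
    exact Padic.norm_p_lt_one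
  have hsplit : ((Ideal.span {(p : ℤ)}).primesOver (𝓞 K)).ncard = 2 := hHp p hpp (dvd_refl p)
  have hgood : W.HasGoodReductionAtPrime p := hord.1
  have hpN : ¬ p ∣ W.conductorNorm ℤ := fun h ↦
    (W.dvd_conductorNorm_iff_not_hasGoodReductionAtPrime p).mp h hgood
  obtain ⟨ι₀⟩ := PadicAlgCl.nonempty_ringEquiv_complex p
  obtain ⟨ι', -, hι'⟩ := X11b.exists_datum_forall_mem_iff p ι₀ hK hpv
  -- frame 1: Thm. 5.7 (1) — torsion and BOTH rational halves
  obtain ⟨ΩK₁, Ωp₁, L₁, hΩK₁, hL₁, htors, hrat⟩ :=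
    h57 ι' W K v vbar κ γ Dt.isNewformOf hp hord hirrK hK hHN hsplit hodd h3 hι' hvbar hne hκ
  obtain ⟨⟨⟨k, hk⟩, k', hk'⟩, -⟩ := hrat (toUnr p) (coe_toUnr p)
  -- frame 3: the μ-local membership datum — `j(s)·L₃ ∈ ch·R₀⟦T⟧`, `μ(s) = 0`
  obtain ⟨ΩK₃, Ωp₃, L₃, hΩK₃, hL₃, s, ⟨m, hm⟩, hL₃mem⟩ := hloc ι' hι'
  -- frame 2: Prop. 4.2.2 — a unit coefficient
  obtain ⟨ΩK₂, Ωp₂, L₂, hΩK₂, hL₂, hμ⟩ :=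
    h422 ι' W K v κ γ Dt.isNewformOf hp2' hgood hK hHN hsplit hodd h3 hirrK hpv hι' hκ hγ
  -- frame 4: Thm. 5.1.3 at `τ_* P`, read through THE infinite place
  obtain ⟨w₀⟩ := (inferInstance : Nonempty (InfinitePlace K))
  obtain ⟨τ, hP'⟩ := exists_algHom_map_map_eq hK ιC w₀ Dt H hP
  obtain ⟨ΩK₄, Ωp₄, L₄, hΩK₄, hL₄, u, hu⟩ :=
    h513 ι' W K v κ γ Dt H w₀ ι (WeierstrassCurve.Affine.Point.map (W' := W) τ P) hp2 hpN hK hsplit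
      hpv hι' hHN hodd h3 hκ hγ hP' hv
  -- frame rigidity: same ideal, same constant term
  have hΩp₁ := coe_units_ne_zero Ωp₁
  have hΩp₂ := coe_units_ne_zero Ωp₂
  have hΩp₃ := coe_units_ne_zero Ωp₃
  have hΩp₄ := coe_units_ne_zero Ωp₄
  have h21 : Ideal.span ({L₂} : Set (UnrSeries p)) = Ideal.span {L₁} :=
    X11b.R1.span_singleton_eq_of_isBDPLFunction hp2 hK hκ hγ hΩK₁ hΩK₂ hΩp₁ hΩp₂ hL₁ hL₂
  have h31 : Ideal.span ({L₃} : Set (UnrSeries p)) = Ideal.span {L₁} :=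
    X11b.R1.span_singleton_eq_of_isBDPLFunction hp2 hK hκ hγ hΩK₁ hΩK₃ hΩp₁ hΩp₃ hL₁ hL₃
  have h41 : PowerSeries.constantCoeff L₄ = PowerSeries.constantCoeff L₁ :=
    X11b.constantCoeff_eq_of_isBDPLFunction hp2 hK hκ hγ hΩK₁ hΩK₄ hΩp₁ hΩp₄ hL₁ hL₄
  -- a generator `F` of `ch_Λ(𝒳)`; the extended ideal is `(F')`, `F' = map toUnr F`
  obtain ⟨F, hF⟩ :=
    (charIdeal_isPrincipal_holds p (Castella2018.AcSelmer.XAc (W.baseChange K) p κ vbar ∅ γ)).principal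
  have hF' : Castella2018.AcSelmer.XAc.charIdeal (W.baseChange K) p κ vbar ∅ γ = Ideal.span {F} := hF
  set F' : UnrSeries p := PowerSeries.map (toUnr p) F with hF'def
  have hI : (Castella2018.AcSelmer.XAc.charIdeal (W.baseChange K) p κ vbar ∅ γ).map
      (PowerSeries.map (toUnr p)) = Ideal.span {F'} := by
    rw [hF', Ideal.map_span, Set.image_singleton]
  -- (1) `C(p^k') · F' ∈ (L₁)` and (1') `C(p^k) · L₁ ∈ (F')`
  have h1 : C ((p : unrIntegers p) ^ k') * F' ∈ Ideal.span ({L₁} : Set (UnrSeries p)) :=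
    hk' F' (by rw [hI]; exact Ideal.mem_span_singleton_self F')
  have h1' : C ((p : unrIntegers p) ^ k) * L₁ ∈ Ideal.span ({F'} : Set (UnrSeries p)) := by
    rw [hI] at hk; exact hk
  -- (2) `j(s) · L₁ ∈ (F')`, `j(s)` with a unit coefficient
  have h2 : PowerSeries.map (toUnr p) s * L₁ ∈ Ideal.span ({F'} : Set (UnrSeries p)) := by
    obtain ⟨V, hV⟩ := Ideal.span_singleton_eq_span_singleton.mp h31
    rw [hI] at hL₃mem
    rw [← hV, ← mul_assoc]
    exact Ideal.mul_mem_right _ _ hL₃mem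
  have hs : ∃ m : ℕ, IsUnit (coeff m (PowerSeries.map (toUnr p) s)) :=
    ⟨m, by rw [PowerSeries.coeff_map]; exact hm.map (toUnr p)⟩
  -- (3) `μ(L₁) = 0`
  obtain ⟨n, hn⟩ := exists_firstUnitCoeffAt_of_span_eq h21 hμ
  -- the s-robust μ-comparison (T2): `(F') = (L₁)`
  have hspan : Ideal.span ({F'} : Set (UnrSeries p)) = Ideal.span {L₁} :=
    hT2 p F' L₁ (PowerSeries.map (toUnr p) s) k k' n h1' h1 hn hs h2
  -- the value at `𝟙`, moved to `L₁` and to `P`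
  have hlog : padicLogOmega W p ι (WeierstrassCurve.Affine.Point.map (W' := W) τ P) ^ 2 =
      padicLogOmega W p ι P ^ 2 :=
    sq_padicLogOmega_map_eq_of_isHeegnerPoint W hK hHN ι ⟨Dt, H, ιC, hP⟩ τ
  rw [hlog] at hu
  have hval : L₁.HasValueAt 0 (((u : unrIntegers p) : ℂ_[p]) *
      algebraMap ℚ_[p] ℂ_[p] (((Dt.c : ℚ_[p])⁻¹) ^ 2 *
        (1 - (W.frobeniusTrace p : ℚ_[p]) * (p : ℚ_[p])⁻¹ + (p : ℚ_[p])⁻¹) ^ 2 *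
        padicLogOmega W p ι P ^ 2)) := by
    have h0 := UnrSeries.hasValueAt_zero L₁
    rw [← h41, ← UnrSeries.eq_constantCoeff_of_hasValueAt_zero hu] at h0
    exact h0
  obtain ⟨u', hu'⟩ := exists_unit_constantCoeff_eq hspan u hval
  refine ⟨htors, F, hF', u', ?_⟩
  rw [hu']
  unfold padicLogOmega
  ring

/-! ## §2 The valuation currency (the bookkeeping of `YanZhu2026.hasCharValuationAt_of_heegnerDivisibility`,
class-free; `ord_p` of the right-hand side is the lead's public `CompositeTransferX10b.valuation_unit_mul_bdpShape`,
p607253) -/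


/-- **The composite in the valuation currency `AcSelmer.XAc.HasCharValuationAt … n ∧ n = …`** for EVERY
generator `G` with `G(0) ≠ 0`, from a μ-local membership datum — the statement shape of g0's `B₃¹`/`B₃⁰`
stubs and of the lead's `compositeValuation_of_printFacts_of_pinnedTransfer`, with the class-number binder
GONE and the transfer μ-localised. -/
theorem hasCharValuationAt_of_muLocalMembership (hT2 : Stmt.stub_muComparison_sLocalised)
    (h57 : thm57_isTorsion_charIdealXGr_eq_bdpLFunction)
    (h422 : BurungaleCastellaSkinner2025.prop422_exists_isBDPLFunction_mu_eq_zero)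
    (h513 : thm513_exists_isBDPLFunction_valueAtOne_disc)
    (W : WeierstrassCurve ℚ) [W.IsElliptic] [W.IsGloballyMinimal] [NeZero (W.conductorNorm ℤ)]
    (p : ℕ) [Fact p.Prime] (hp : 3 ≤ p) (hord : GoodOrd W p)
    (K : Type) [Field K] [NumberField K] (hK : IsImaginaryQuadratic K)
    (hHN : SatisfiesHeegnerHypothesis (W.conductorNorm ℤ) K) (hHp : SatisfiesHeegnerHypothesis p K)
    (hodd : Odd (NumberField.discr K)) (h3 : NumberField.discr K ≠ -3)
    (hirrK : (W.baseChange K).HasIrreducibleModPGaloisRep p)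
    (ι : K →+* ℚ_[p]) (v vbar : HeightOneSpectrum (𝓞 K))
    (hv : ∀ x : 𝓞 K, x ∈ v.asIdeal ↔ ‖ι (x : K)‖ < 1)
    (hvbar : ((p : ℕ) : 𝓞 K) ∈ vbar.asIdeal) (hne : vbar ≠ v)
    (κ : ZpExtension K p) (hκ : κ.IsAnticyclotomic)
    (γ : absoluteGaloisGroup K) [Fact (κ.IsTopGenerator γ)]
    (Dt : ModularParametrizationData W (W.conductorNorm ℤ))
    (H : HeegnerDatum (W.conductorNorm ℤ) (NumberField.discr K)) (ιC : K →+* ℂ)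
    (P : (W.baseChange K).toAffine.Point)
    (hP : WeierstrassCurve.Affine.Point.map ιC.toRatAlgHom P = heegnerPointComplex Dt H)
    (hloc : MuLocalMembership p W K v vbar κ γ Dt.f)
    (G : IwasawaAlgebra p) (hG : AcSelmer.XAc.charIdeal (W.baseChange K) p κ vbar ∅ γ = Ideal.span {G})
    (hG0 : PowerSeries.constantCoeff G ≠ 0) :
    ∃ n : ℕ, AcSelmer.XAc.HasCharValuationAt (W.baseChange K) p κ vbar ∅ γ n ∧
      (n : ℤ) = 2 * ((padicValInt p (1 - W.frobeniusTrace p + p) : ℤ) - 1 + padicLogOrd W p ι P) -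
        2 * (padicValInt p Dt.c : ℤ) := by
  obtain ⟨htors, F, hF, u, hu⟩ := generator_constantCoeff_of_muLocalMembership hT2 h57 h422 h513 W p hp
    hord K hK hHN hHp hodd h3 hirrK ι v vbar hv hvbar hne κ hκ γ Dt H ιC P hP hloc
  -- `G = F · w` for a unit `w` of `Λ`; `w(0)` is a unit of `ℤ_p`
  obtain ⟨w, rfl⟩ := Ideal.span_singleton_eq_span_singleton.mp (hF.symm.trans hG)
  have hw : IsUnit (PowerSeries.constantCoeff (w : IwasawaAlgebra p)) :=
    PowerSeries.isUnit_constantCoeff _ w.isUnit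
  have hu' : ((PowerSeries.constantCoeff (F * (w : IwasawaAlgebra p)) : ℤ_[p]) : ℚ_[p]) =
      (((u * hw.unit : ℤ_[p]ˣ) : ℤ_[p]) : ℚ_[p]) * ((Dt.c : ℚ_[p])⁻¹) ^ 2 *
        (1 - (W.frobeniusTrace p : ℚ_[p]) * (p : ℚ_[p])⁻¹ + (p : ℚ_[p])⁻¹) ^ 2 *
        ((W.baseChange ℚ_[p]).padicLogPoint (formalIndex W p • padicPointOf W p ι P) /
          (formalIndex W p : ℚ_[p])) ^ 2 := by
    rw [map_mul, PadicInt.coe_mul, hu, Units.val_mul, PadicInt.coe_mul, IsUnit.unit_spec]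
    ring
  have hrhs : (((u * hw.unit : ℤ_[p]ˣ) : ℤ_[p]) : ℚ_[p]) * ((Dt.c : ℚ_[p])⁻¹) ^ 2 *
      (1 - (W.frobeniusTrace p : ℚ_[p]) * (p : ℚ_[p])⁻¹ + (p : ℚ_[p])⁻¹) ^ 2 *
      ((W.baseChange ℚ_[p]).padicLogPoint (formalIndex W p • padicPointOf W p ι P) /
        (formalIndex W p : ℚ_[p])) ^ 2 ≠ 0 := by
    rw [← hu']
    exact PadicInt.coe_ne_zero.2 hG0
  have hval := congrArg Padic.valuation hu'
  rw [PadicInt.valuation_coe,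
    CompositeTransferX10b.valuation_unit_mul_bdpShape (u * hw.unit) Dt.c (W.frobeniusTrace p) _ _ hrhs] at hval
  refine ⟨(PowerSeries.constantCoeff (F * (w : IwasawaAlgebra p))).valuation,
    AcSelmer.XAc.hasCharValuationAt_of_eq htors hG hG0 rfl, ?_⟩
  rw [hval, padicLogOrd]

/-! ## §3 The σ-bridge (g0's `composite_transfer_x10b` bridge, abstracted over the valuation statement;
kernel-checked) -/

/-- From the valuation statement at every `(ι₂, v, vbar, G)` and JSW Thm. 3.3.1 (route item
`JSWAnticyclotomicControl`, by name) to the crux's conclusion `X11b.IMCWaldspurgerOnTreeGoodAt` at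
`inducedPlace ι`: other prime `w`, embedding `ιw = ι ∘ σ`, rank-one invariance of `ord_p log_ω P`. -/
theorem imcWaldspurger_of_charValuation
    (h331 : Summit.BirchSwinnertonDyer.BirchSwinnertonDyer.Theses.PrintX10b.JSWAnticyclotomicControl)
    (W : WeierstrassCurve ℚ) [W.IsElliptic] [W.IsGloballyMinimal] [NeZero (W.conductorNorm ℤ)]
    (p : ℕ) [Fact p.Prime] (hp : 3 ≤ p) (hgood : W.HasGoodReductionAtPrime p)
    (K : Type) [Field K] [NumberField K] (hK : IsImaginaryQuadratic K)
    (hHN : SatisfiesHeegnerHypothesis (W.conductorNorm ℤ) K) (hHp : SatisfiesHeegnerHypothesis p K)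
    (hirrK : (W.baseChange K).HasIrreducibleModPGaloisRep p) (ι : K →+* ℚ_[p])
    (κ : ZpExtension K p) (hκ : κ.IsAnticyclotomic) (γ : absoluteGaloisGroup K) [Fact (κ.IsTopGenerator γ)]
    (Dt : ModularParametrizationData W (W.conductorNorm ℤ)) (hc : ¬ (p : ℤ) ∣ Dt.c)
    (P : (W.baseChange K).toAffine.Point) (hrk : (W.baseChange K).mordellWeilRank = 1)
    (hfinp : Finite (AddCommGroup.primaryComponent (W.baseChange K).sha p)) (hPinf : ¬ IsOfFinAddOrder P)
    (hcv : ∀ (ι₂ : K →+* ℚ_[p]) (v vbar : HeightOneSpectrum (𝓞 K)),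
      (∀ x : 𝓞 K, x ∈ v.asIdeal ↔ ‖ι₂ (x : K)‖ < 1) → ((p : ℕ) : 𝓞 K) ∈ vbar.asIdeal → vbar ≠ v →
      ∀ (G : IwasawaAlgebra p), AcSelmer.XAc.charIdeal (W.baseChange K) p κ vbar ∅ γ = Ideal.span {G} →
      PowerSeries.constantCoeff G ≠ 0 →
      ∃ n : ℕ, AcSelmer.XAc.HasCharValuationAt (W.baseChange K) p κ vbar ∅ γ n ∧
        (n : ℤ) = 2 * ((padicValInt p (1 - W.frobeniusTrace p + p) : ℤ) - 1 + padicLogOrd W p ι₂ P) -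
          2 * (padicValInt p Dt.c : ℤ)) :
    X11b.IMCWaldspurgerOnTreeGoodAt p κ (X11b.inducedPlace ι) γ ι P := by
  have h331' : thm331_anticyclotomicControl := h331
  -- the other prime `w` above `p`, of degree one, and THE embedding at it
  obtain ⟨w, hw, hwne⟩ := X11b.exists_other_prime hHp (X11b.inducedPlace ι)
    (X11b.natCast_mem_inducedPlace ι)
  have hsplit : X11b.SplitsIn K p := hHp p Fact.out (dvd_refl p)
  obtain ⟨he, hf⟩ := X11b.degreeOne_of_splitsIn hK.1 hsplit hw
  set ιw : K →+* ℚ_[p] := X11b.embAt K p w hw he hf with hιw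
  -- a generator with non-zero constant term of the module strict at `v = inducedPlace ι`, from JSW
  obtain ⟨-, F, hF, hF0, -⟩ := h331' W p hp hgood K hK hHp hHN hirrK ι (X11b.inducedPlace ι)
    (X11b.mem_inducedPlace_iff ι) κ hκ γ hrk hfinp P hPinf
  -- the valuation statement at the embedding `ιw`, strict prime `inducedPlace ι`
  obtain ⟨n, hn, hval⟩ := hcv ιw w (X11b.inducedPlace ι)
    (X11b.mem_asIdeal_iff_norm_embAt_lt_one w hw he hf) (X11b.natCast_mem_inducedPlace ι)
    (fun h ↦ hwne h.symm) F hF hF0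
  -- `ιw = ι ∘ σ` for an involution `σ`; the log valuations agree in rank one
  obtain ⟨σ, hσ, hισ⟩ := X11b.exists_involutive_comp_eq hK.1 ι ιw
  have hlog : padicLogOrd W p ιw P = X11b.padicLogOrd W p ι P := by
    rw [← hισ, ← X11b.padicLogOrd_eq_literature]
    exact padicLogOrd_comp_eq_of_rank_one W p (by omega) σ hσ ι hrk P hPinf
  have hc0 : padicValInt p Dt.c = 0 := padicValInt.eq_zero_of_not_dvd hc
  refine ⟨n, (X11b.AcSelmer.hasCharValuationAt_iff_literature _ p κ (X11b.inducedPlace ι) ∅ γ n).mpr hn,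
    ?_⟩
  rw [hlog] at hval
  omega

/-! ## §4 Compositions (kernel-checked, no `sorry`) -/

/-- **B₃ (rev 19, BY NAME) ⇐ T1 + T2 + Yan–Zhu Thm. 5.7 (1) + BCS Prop. 4.2.2 + CGLS Thm. 5.1.3 + the route's
by-name item `JSWAnticyclotomicControl`.** `ClassX10` supplies `p = 3`, `GoodOrd W p`; NO split on `3 ∣ h_K`. -/
theorem TwoSidedLinkAnyClassNumberX10b_of
    (hT1 : Stmt.stub_bdpMem_muLocalised_classFree) (hT2 : Stmt.stub_muComparison_sLocalised)
    (h57 : thm57_isTorsion_charIdealXGr_eq_bdpLFunction)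
    (h422 : BurungaleCastellaSkinner2025.prop422_exists_isBDPLFunction_mu_eq_zero)
    (h513 : thm513_exists_isBDPLFunction_valueAtOne_disc)
    (h331 : Summit.BirchSwinnertonDyer.BirchSwinnertonDyer.Theses.PrintX10b.JSWAnticyclotomicControl) :
    Summit.BirchSwinnertonDyer.BirchSwinnertonDyer.Theses.PrintX10b.TwoSidedLinkAnyClassNumberX10b := by
  intro W _ _ p _ _ K _ _ hX hns hcm hK hodd h3 hHN hHp hirrK ι κ hκ γ _ Dt hc H ιC P hP hrk hfinp
    hPinf hHow
  have hp : 3 ≤ p := hX.three_le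
  obtain ⟨hgood, hord⟩ := id hX.goodOrd
  exact imcWaldspurger_of_charValuation h331 W p hp hgood K hK hHN hHp hirrK ι κ hκ γ Dt hc P hrk hfinp
    hPinf (fun ι₂ v vbar hv hvbar hne G hG hG0 ↦
      hasCharValuationAt_of_muLocalMembership hT2 h57 h422 h513 W p hp ⟨hgood, hord⟩ K hK hHN hHp hodd h3
        hirrK ι₂ v vbar hv hvbar hne κ hκ γ Dt H ιC P hP
        (muLocalMembership_of_unpinned hT1 W p hp ⟨hgood, hord⟩ K hK hHN hHp hodd h3 hirrK v vbar hvbar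
          hne κ hκ γ Dt hHow) G hG hG0)

/-- The composed line from the stubs, the three printed frame facts and the by-name route item
(sorries only through `stub_*`). -/
theorem TwoSidedLinkAnyClassNumberX10b_of_stubs
    (h57 : thm57_isTorsion_charIdealXGr_eq_bdpLFunction)
    (h422 : BurungaleCastellaSkinner2025.prop422_exists_isBDPLFunction_mu_eq_zero)
    (h513 : thm513_exists_isBDPLFunction_valueAtOne_disc)
    (h331 : Summit.BirchSwinnertonDyer.BirchSwinnertonDyer.Theses.PrintX10b.JSWAnticyclotomicControl) :
    Summit.BirchSwinnertonDyer.BirchSwinnertonDyer.Theses.PrintX10b.TwoSidedLinkAnyClassNumberX10b :=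
  TwoSidedLinkAnyClassNumberX10b_of stub_bdpMem_muLocalised_classFree stub_muComparison_sLocalised h57
    h422 h513 h331

/-- **The PINNED B₃ body (rev-19 binder list with the containment hypothesis pinned, PIN-1 / REF-104 —
the shape announced for rev 20) ⇐ T1p + T2 + the same print.** This is the statement of record of the line
once the crux is re-typed; until then it is kernel evidence that the pin costs the line nothing. -/
theorem twoSidedLinkPinned_of
    (hT1p : Stmt.stub_bdpMem_muLocalised_pinned) (hT2 : Stmt.stub_muComparison_sLocalised)
    (h57 : thm57_isTorsion_charIdealXGr_eq_bdpLFunction)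
    (h422 : BurungaleCastellaSkinner2025.prop422_exists_isBDPLFunction_mu_eq_zero)
    (h513 : thm513_exists_isBDPLFunction_valueAtOne_disc)
    (h331 : Summit.BirchSwinnertonDyer.BirchSwinnertonDyer.Theses.PrintX10b.JSWAnticyclotomicControl) :
    ∀ (W : WeierstrassCurve ℚ) [W.IsElliptic] [W.IsGloballyMinimal] (p : ℕ) [Fact p.Prime]
      [NeZero (W.conductorNorm ℤ)] (K : Type) [Field K] [NumberField K],
      ClassX10 W p → ¬ Surj W 3 → ¬ W.HasCM → IsImaginaryQuadratic K → Odd (NumberField.discr K) →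
      NumberField.discr K ≠ -3 → SatisfiesHeegnerHypothesis (W.conductorNorm ℤ) K →
      SatisfiesHeegnerHypothesis p K → (W.baseChange K).HasIrreducibleModPGaloisRep p →
      ∀ (ι : K →+* ℚ_[p]) (κ : ZpExtension K p), κ.IsAnticyclotomic →
      ∀ (γ : absoluteGaloisGroup K) [Fact (κ.IsTopGenerator γ)]
        (Dt : ModularParametrizationData W (W.conductorNorm ℤ)), ¬ (p : ℤ) ∣ Dt.c →
      ∀ (H : HeegnerDatum (W.conductorNorm ℤ) (NumberField.discr K)) (ιC : K →+* ℂ)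
        (P : (W.baseChange K).toAffine.Point),
        WeierstrassCurve.Affine.Point.map ιC.toRatAlgHom P = heegnerPointComplex Dt H →
        (W.baseChange K).mordellWeilRank = 1 →
        Finite (AddCommGroup.primaryComponent (W.baseChange K).sha p) → ¬ IsOfFinAddOrder P →
        (∃ (jbar : AlgebraicClosure K →+* ℂ) (D : (W.baseChange K).LambdaAdicSelmerData κ γ)
            (F : HeegnerFamily (W.conductorNorm ℤ) W K κ jbar) (X : (W.baseChange K).SelmerDualData κ γ),
            ¬ (p : ℤ) ∣ F.Dt.c ∧ heegnerCharIdeal D F ^ 2 ≤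
              Module.charIdeal (IwasawaAlgebra p) (Submodule.torsion (IwasawaAlgebra p) X.X)) →
        X11b.IMCWaldspurgerOnTreeGoodAt p κ (X11b.inducedPlace ι) γ ι P := by
  intro W _ _ p _ _ K _ _ hX hns hcm hK hodd h3 hHN hHp hirrK ι κ hκ γ _ Dt hc H ιC P hP hrk hfinp
    hPinf hHow
  have hp : 3 ≤ p := hX.three_le
  obtain ⟨hgood, hord⟩ := id hX.goodOrd
  exact imcWaldspurger_of_charValuation h331 W p hp hgood K hK hHN hHp hirrK ι κ hκ γ Dt hc P hrk hfinp
    hPinf (fun ι₂ v vbar hv hvbar hne G hG hG0 ↦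
      hasCharValuationAt_of_muLocalMembership hT2 h57 h422 h513 W p hp ⟨hgood, hord⟩ K hK hHN hHp hodd h3
        hirrK ι₂ v vbar hv hvbar hne κ hκ γ Dt H ιC P hP
        (muLocalMembership_of_pinned hT1p W p hp ⟨hgood, hord⟩ K hK hHN hHp hodd h3 hirrK v vbar hvbar
          hne κ hκ γ Dt hHow) G hG hG0)

/-! ## §5 Kernel evidence: T1p is WEAKER than the lead's pinned transfer `h59gp`; T1 at `p ∤ h_K` IS the typed
Thm. 5.9 (with `s = 1`) -/

/-- The lead's pinned class-free transfer hypothesis `h59gp` (p607932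
`composite_of_printFacts_of_pinnedTransfer`, binder type copied letter for letter): Yan–Zhu Thm. 5.9 (2) ⟹ (1)
at the trivial localisation, pinned, class-free, conclusion `L ∈ ch·R₀⟦T⟧`. A `Prop` here only to state the
comparison; it is a HYPOTHESIS of the lead's theorems, not a tree fact. -/
def LeadPinnedTransfer : Prop :=
  ∀ {p : ℕ} [Fact p.Prime] (ι' : PadicAlgCl p ≃+* ℂ) (W : WeierstrassCurve ℚ) [W.IsElliptic]
    [W.IsGloballyMinimal] (K : Type) [Field K] [NumberField K] (v vbar : HeightOneSpectrum (𝓞 K))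
    (κ : ZpExtension K p) (γ : absoluteGaloisGroup K) [Fact (κ.IsTopGenerator γ)] {N : ℕ} [NeZero N]
    {f : CuspForm (CongruenceSubgroup.Gamma0 N) 2} (jbar : AlgebraicClosure K →+* ℂ)
    (_ : IsNewformOf W f),
    N = W.conductorNorm ℤ → 3 ≤ p → GoodOrd W p → (W.baseChange K).HasIrreducibleModPGaloisRep p →
    IsImaginaryQuadratic K → SatisfiesHeegnerHypothesis N K →
      ((Ideal.span {(p : ℤ)}).primesOver (𝓞 K)).ncard = 2 →
      Odd (NumberField.discr K) → NumberField.discr K ≠ -3 → κ.IsAnticyclotomic →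
    (∀ (w : InfinitePlace K) (k : 𝓞 K), k ∈ v.asIdeal ↔ ‖ι'.symm (w.embedding (k : K))‖ < 1) →
      ((p : ℕ) : 𝓞 K) ∈ vbar.asIdeal → vbar ≠ v →
    ∃ (ΩK : ℂ) (Ωp : (unrIntegers p)ˣ) (L : UnrSeries p),
      ΩK ≠ 0 ∧ IsBDPLFunction ι' v κ γ f ΩK ((Ωp : unrIntegers p) : ℂ_[p]) L ∧
      ∀ (D : (W.baseChange K).LambdaAdicSelmerData κ γ) (F : HeegnerFamily N W K κ jbar)
        (X : (W.baseChange K).SelmerDualData κ γ) (j : ℤ_[p] →+* unrIntegers p),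
        ¬ (p : ℤ) ∣ F.Dt.c →
        (∀ x : ℤ_[p], ((j x : unrIntegers p) : ℂ_[p]) = algebraMap ℚ_[p] ℂ_[p] (x : ℚ_[p])) →
        heegnerCharIdeal D F ^ 2 ≤
            Module.charIdeal (IwasawaAlgebra p) (Submodule.torsion (IwasawaAlgebra p) X.X) →
          L ∈ (AcSelmer.XAc.charIdeal (W.baseChange K) p κ vbar ∅ γ).map (PowerSeries.map j)

/-- **`h59gp` ⇒ T1p** with `s = 1`: the μ-line needs strictly less than the lead's pinned hypothesis. -/
theorem muLocalisedPinned_of_leadPinnedTransfer (h : LeadPinnedTransfer) :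
    Stmt.stub_bdpMem_muLocalised_pinned := by
  intro p _ ι' W _ _ _ K _ _ v vbar κ γ _ f jbar hf hp hord hirrK hK hHN hsplit hodd h3 hκ hι' hvbar hne
  obtain ⟨ΩK, Ωp, L, hΩK, hL, hmem⟩ :=
    h ι' W K v vbar κ γ jbar hf rfl hp hord hirrK hK hHN hsplit hodd h3 hκ hι' hvbar hne
  refine ⟨ΩK, Ωp, L, hΩK, hL, fun D F X j hpin hj hle ↦ ⟨1, ⟨0, ?_⟩, ?_⟩⟩
  · rw [PowerSeries.coeff_zero_eq_constantCoeff, map_one]; exact isUnit_one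
  · rw [map_one, one_mul]; exact hmem D F X j hpin hj hle

/-- At `p ∤ h_K`, `stub_bdpMem_muLocalised_classFree`'s conclusion holds with `s = 1` by the typed
Yan–Zhu Thm. 5.9 (`YanZhu2026.bdp_mem_of_heegner_le_of_thm59`): the stub's new content is exactly the
class-number deletion, softened to a μ-localisation.
[cite: YanZhu2024MainConjNonCM, Thm. 5.9 (arXiv:2412.20078v4 l.1283–1293)] -/
theorem bdpMem_muLocalised_of_thm59_of_not_dvd_classNumber
    (h59 : thm59_XGr_isTorsion_bdp_iff_heegnerPoint_localised)
    (p : ℕ) [Fact p.Prime] (ι' : PadicAlgCl p ≃+* ℂ) (W : WeierstrassCurve ℚ) [W.IsElliptic]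
    [W.IsGloballyMinimal] [NeZero (W.conductorNorm ℤ)] (K : Type) [Field K] [NumberField K]
    (v vbar : HeightOneSpectrum (𝓞 K)) (κ : ZpExtension K p) (γ : absoluteGaloisGroup K)
    [Fact (κ.IsTopGenerator γ)] {f : CuspForm (CongruenceSubgroup.Gamma0 (W.conductorNorm ℤ)) 2}
    (jbar : AlgebraicClosure K →+* ℂ) (hf : IsNewformOf W f) (hp : 3 ≤ p) (hord : GoodOrd W p)
    (hirrK : (W.baseChange K).HasIrreducibleModPGaloisRep p) (hK : IsImaginaryQuadratic K)
    (hHN : SatisfiesHeegnerHypothesis (W.conductorNorm ℤ) K)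
    (hsplit : ((Ideal.span {(p : ℤ)}).primesOver (𝓞 K)).ncard = 2)
    (hodd : Odd (NumberField.discr K)) (h3 : NumberField.discr K ≠ -3) (hκ : κ.IsAnticyclotomic)
    (hι : ∀ (w : InfinitePlace K) (k : 𝓞 K), k ∈ v.asIdeal ↔ ‖ι'.symm (w.embedding (k : K))‖ < 1)
    (hvbar : ((p : ℕ) : 𝓞 K) ∈ vbar.asIdeal) (hne : vbar ≠ v)
    (hhK : ¬ p ∣ NumberField.classNumber K) :
    ∃ (ΩK : ℂ) (Ωp : (unrIntegers p)ˣ) (L : UnrSeries p),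
      ΩK ≠ 0 ∧ IsBDPLFunction ι' v κ γ f ΩK ((Ωp : unrIntegers p) : ℂ_[p]) L ∧
      ∀ (D : (W.baseChange K).LambdaAdicSelmerData κ γ)
        (F : HeegnerFamily (W.conductorNorm ℤ) W K κ jbar)
        (X : (W.baseChange K).SelmerDualData κ γ) (j : ℤ_[p] →+* unrIntegers p),
        (∀ x : ℤ_[p], ((j x : unrIntegers p) : ℂ_[p]) = algebraMap ℚ_[p] ℂ_[p] (x : ℚ_[p])) →
        heegnerCharIdeal D F ^ 2 ≤
            Module.charIdeal (IwasawaAlgebra p) (Submodule.torsion (IwasawaAlgebra p) X.X) →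
        ∃ s : IwasawaAlgebra p, (∃ m : ℕ, IsUnit (coeff m s)) ∧
          PowerSeries.map j s * L ∈
            (AcSelmer.XAc.charIdeal (W.baseChange K) p κ vbar ∅ γ).map (PowerSeries.map j) := by
  have hγ : κ.IsTopGenerator γ := Fact.out
  have hyp57 : Thm57Hypotheses (W.conductorNorm ℤ) W K p κ γ :=
    { isElliptic := inferInstance, level := rfl, three_le := hp, goodOrd := hord,
      irreducible := hirrK, isImaginaryQuadratic := hK, heegner := hHN, discr_odd := hodd,
      discr_ne := h3, split := hsplit, not_dvd_classNumber := hhK, anticyclotomic := hκ,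
      topGenerator := hγ }
  obtain ⟨ΩK, Ωp, L, hΩK, hL, hmem⟩ :=
    bdp_mem_of_heegner_le_of_thm59 h59 ι' W v vbar κ γ jbar hyp57 hf hι hvbar hne
  refine ⟨ΩK, Ωp, L, hΩK, hL, fun D F X j hj hle ↦ ⟨1, ⟨0, ?_⟩, ?_⟩⟩
  · rw [PowerSeries.coeff_zero_eq_constantCoeff, map_one]; exact isUnit_one
  · rw [map_one, one_mul]; exact hmem D F X j hj hle

end Summit.BirchSwinnertonDyer.BirchSwinnertonDyer.Cruxes.TwoSidedLinkAnyClassNumberX10b.MuOnlyTransferX10b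

end
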